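import Summits.CriticalPhenomena.PercolationContinuityZ3.Theorems.PercNearOneGluingNoHeavyLowerTailMajorityGluingQCertVec
import Summits.CriticalPhenomena.PercolationContinuityZ3.Theorems.PercNearOneGluingNoHeavyLowerTailMajorityGluingQCertEightFive135L1
import Summits.CriticalPhenomena.PercolationContinuityZ3.Theorems.PercNearOneGluingNoHeavyLowerTailMajorityGluingQCertEightFive135L2
import Summits.CriticalPhenomena.PercolationContinuityZ3.Theorems.PercNearOneGluingNoHeavyLowerTailMajorityGluingQCertEightFive135L3
import Summits.CriticalPhenomena.PercolationContinuityZ3.Theorems.PercNearOneGluingNoHeavyLowerTailMajorityGluingQCertEightFive135R1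
import Summits.CriticalPhenomena.PercolationContinuityZ3.Theorems.PercNearOneGluingNoHeavyLowerTailMajorityGluingQCertEightFive135R2
import Summits.CriticalPhenomena.PercolationContinuityZ3.Theorems.PercNearOneGluingNoHeavyLowerTailMajorityGluingQCertEightFive135R3
import Summits.CriticalPhenomena.PercolationContinuityZ3.Theorems.PercNearOneGluingNoHeavyLowerTailMajorityGluingQCertEightFive135R4
import Summits.CriticalPhenomena.PercolationContinuityZ3.Theorems.PercNearOneGluingNoHeavyLowerTailMajorityGluingQCertEightFive135R5
import Summits.CriticalPhenomena.PercolationContinuityZ3.Theorems.PercNearOneGluingNoHeavyLowerTailMajorityGluingQCertEightFive135S1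
import HarnessLib

/-!
# The `(8,5)` certificate with constant `27/20`: assembly and structural check (lane prim-rate, constants-miner 1, gen 35; CANDIDATES §GEN-35)

Support file for the closed crux `NoHeavyLowerTail` (stmt-CriticalPhenomena-4575), majority-gluing line.  `eightFive135` assembles the data files; `checkW` by `decide +kernel`; the quadratic check is chunked over the variable rows in `…QCertEightFive135Q*`.  No sorries.
-/

namespace Summit.CriticalPhenomena.PercolationContinuityZ3.Theorems

namespace HubOnly
namespace QCert

/-- **The `(8,5)` certificate for the constant `27/20`** (case family `1`). The degree-2 certificate census/g35/jobs/j278778/CERT5_8_5_c27over20.json (mine-1 gen 35, kit j278778: cert5.py — cutting planes on the moment side over ALL hub-rooted van den Berg–Kahn rows (separated from the 3⁸×3⁸ instances) and the 2×2 squares of variables/cylinders, case family `A` = «`E_x = μ(x attached, ≥ 5 cut)`», exact INTEGER multipliers (1 838 marginal×variable and 714 case entries in 256 groups, 1 333 row instances, 85 squares), re-verified in the Lean semantics by census/g35/cert/gen5.py: `S ≥ 0` on all 33 153 pairs; variables `x_K`, `K < 256` = cut patterns of eight relays, `x_256 = δ`). -/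
def eightFive135 : Cert := ⟨8, 5, 27, 20, 1, eightFive135Lin1 ++ eightFive135Lin2 ++ eightFive135Lin3, eightFive135Rows1 ++ eightFive135Rows2 ++ eightFive135Rows3 ++ eightFive135Rows4 ++ eightFive135Rows5, eightFive135Sqs1⟩

set_option maxHeartbeats 0 in
/-- The structural check passes. -/
theorem eightFive135_checkW : eightFive135.checkW = true := by decide +kernel

end QCert
end HubOnly

end Summit.CriticalPhenomena.PercolationContinuityZ3.Theorems
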